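import Summits.BirchSwinnertonDyer.BirchSwinnertonDyer.Theses.AdditiveKolyvaginRoad
import Summits.BirchSwinnertonDyer.BirchSwinnertonDyer.Theorems.KatoDescentTamePotSupersingularDefs
import Literature.NumberTheory.EllipticCurves.CastellaGrossiSkinner2025.AnticyclotomicMainConjectures
import Literature.NumberTheory.EllipticCurves.GreenbergVatsal2000.CongruentCurves
import Literature.NumberTheory.EllipticCurves.IwasawaAlgebra

/-! # Sketch — crux idea `residual-bdp-transport` on KS′ (`LevelKolyvaginSystemsAdditive`, item 21396)

First lemmas of the line RESIDUAL TRANSPORT OF THE BDP MAIN CONJECTURE ACROSS THE ADDITIVE PRIME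
(Greenberg–Vatsal ∕ Emerton–Pollack–Weston ∕ Lei–Müller–Xia (Forum Math. 2023, arXiv:2302.06553,
printed under `p ∤ N`) transposed to one congruent form with `p² ∣ N`). Nothing is proved here; the two
`def … : Prop` below only have to ELABORATE over existing declarations (crux-ideate protocol). -/

set_option autoImplicit false
set_option linter.dupNamespace false

noncomputable section

open scoped Classical

open WeierstrassCurve NumberField IsDedekindDomain
  Literature.NumberTheory.EllipticCurves Literature.NumberTheory.EllipticCurves.ModularForms
  Literature.NumberTheory.EllipticCurves.Rank1Residual Literature.NumberTheory.GaloisRepresentations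
  Literature.NumberTheory.EllipticCurves.IwasawaAlgebra
  Literature.NumberTheory.EllipticCurves.GreenbergVatsal2000
  Literature.NumberTheory.EllipticCurves.Castella2018
  Summit.BirchSwinnertonDyer.BirchSwinnertonDyer.Theorems
  Summit.BirchSwinnertonDyer.BirchSwinnertonDyer.Theses.AdditiveKolyvaginRoad

namespace Summit.BirchSwinnertonDyer.BirchSwinnertonDyer.Cruxes.LevelKolyvaginSystemsAdditive.ResidualBdpTransport

/-- (RT3-alg) **The Greenberg–Vatsal pin**, pure commutative algebra over any DVR `𝒪` with uniformiser `ϖ`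
(meant: `𝒪 = ℤ_p^{ur}`, `Λ^{ur} = 𝒪⟦T⟧`): if `F, G ∈ 𝒪⟦T⟧` have `μ(F) = 0`, the SAME residual order
(`λ(F) = λ(G)`, read as the `T`-adic order of the reductions mod `ϖ`) and ONE RATIONAL one-sided divisibility
`F ∣ ϖ^a · G`, then `(F) = (G)`. This is the step that turns «transported `λ`, `μ`» + «one inclusion in
`Λ^{ur} ⊗ ℚ` for `f_E`, either direction» into the full equality of ideals; no Weierstrass preparation needed. -/
def GVPinning : Prop :=
  ∀ (𝒪 : Type) [CommRing 𝒪] [IsDomain 𝒪] [IsDiscreteValuationRing 𝒪] (ϖ : 𝒪), Irreducible ϖ →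
    ∀ (F G H : PowerSeries 𝒪) (a : ℕ),
      PowerSeries.map (IsLocalRing.residue 𝒪) F ≠ 0 →
      (PowerSeries.map (IsLocalRing.residue 𝒪) F).order = (PowerSeries.map (IsLocalRing.residue 𝒪) G).order →
      algebraMap 𝒪 (PowerSeries 𝒪) (ϖ ^ a) * G = F * H →
      Associated F G

/-- (RT2 = RT-alg) **Residual transport of the anticyclotomic BDP–Greenberg Selmer invariants ACROSS THE
ADDITIVE PRIME.** `W/ℚ` has ADDITIVE potentially supersingular reduction at `p ≥ 5` (`Addv W p`), `X/ℚ` is a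
`p`-GOOD «avatar» with `X[p] ≅ W[p]` (traces congruent mod `p` away from `p N_W N_X`, `W[p]` onto); `K`
imaginary quadratic with `p` split, `vbar ∣ p` the STRICT prime, `κ` the anticyclotomic `ℤ_p`-extension with
topological generator `γ`; `S` a finite set of primes of `K` away from `p` containing every prime of bad
reduction of `W` or `X` (imprimitive conditions there), both conductors Heegner for `K`; and the common residual
local vanishing `W(ℚ_p)[p] = 0 = X(ℚ_p)[p]` (⟺ `ρ̄^{G_{ℚ_p}} = 0`, a property of `ρ̄`). CLAIM: if the `S`-imprimitive
dual `X_ac^S(X/K_∞)` (Castella 2018 Def. 2.2 object of the tree, strict at `vbar`, relaxed at `v`, NO condition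
reading the reduction type at `p`) is `Λ`-torsion with `μ = 0`, then so is `X_ac^S(W/K_∞)`, and the
`λ`-invariants agree. Printed for `p ∤ N_W N_X` [Lei–Müller–Xia 2023, Thm. 3.4 ∕ Thm. 1; Hatley–Lei 2019;
Castella–Kim–Longo 2017]; the bet is that the printed proof is type-blind at `p`. -/
def ResidualSelmerTransportAdditive : Prop :=
  ∀ (W X : WeierstrassCurve ℚ) [W.IsElliptic] [W.IsGloballyMinimal] [X.IsElliptic] [X.IsGloballyMinimal]
    (p : ℕ) [Fact p.Prime] (K : Type) [Field K] [NumberField K]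
    (vbar : HeightOneSpectrum (𝓞 K)) (κ : ZpExtension K p) (γ : Field.absoluteGaloisGroup K)
    [Fact (κ.IsTopGenerator γ)] (S : Set (HeightOneSpectrum (𝓞 K))),
    5 ≤ p → Addv W p → ¬ (p ∣ X.conductorNorm ℤ) → W.HasSurjectiveModNGaloisRep p →
    IsCongruentModP p W X →
    (∀ Q : (W.baseChange ℚ_[p]).toAffine.Point, p • Q = 0 → Q = 0) →
    (∀ Q : (X.baseChange ℚ_[p]).toAffine.Point, p • Q = 0 → Q = 0) →
    IsImaginaryQuadratic K → ((Ideal.span {(p : ℤ)}).primesOver (𝓞 K)).ncard = 2 →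
    ((p : ℕ) : 𝓞 K) ∈ vbar.asIdeal → κ.IsAnticyclotomic →
    SatisfiesHeegnerHypothesis (W.conductorNorm ℤ) K → SatisfiesHeegnerHypothesis (X.conductorNorm ℤ) K →
    S.Finite → (∀ w ∈ S, ((p : ℕ) : 𝓞 K) ∉ w.asIdeal) →
    (∀ w : HeightOneSpectrum (𝓞 K), ((W.conductorNorm ℤ * X.conductorNorm ℤ : ℕ) : 𝓞 K) ∈ w.asIdeal →
      ((p : ℕ) : 𝓞 K) ∉ w.asIdeal → w ∈ S) →
    Module.IsTorsion (IwasawaAlgebra p) (AcSelmer.XAc (X.baseChange K) p κ vbar S γ) →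
    muInvariant p (AcSelmer.XAc (X.baseChange K) p κ vbar S γ) = 0 →
      Module.IsTorsion (IwasawaAlgebra p) (AcSelmer.XAc (W.baseChange K) p κ vbar S γ) ∧
      muInvariant p (AcSelmer.XAc (W.baseChange K) p κ vbar S γ) = 0 ∧
      lambdaInvariant p (AcSelmer.XAc (W.baseChange K) p κ vbar S γ) =
        lambdaInvariant p (AcSelmer.XAc (X.baseChange K) p κ vbar S γ)

/-- (RT1 = RT-an) **Residual transport of the BDP `p`-adic `L`-function across the additive prime** in the
tree's currency `IsBDPLFunction` (Castella's normalisation; its interpolation factor already reads `ε_p = 0`,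
`a_p = 0` off `p ∣ N`, i.e. the factor is `1` at `p² ∣ N`): for BDP functions `L_W, L_X ∈ R₀⟦T⟧` of the newforms
of `W` (additive at `p`) and of its `p`-good avatar `X`, built with the SAME CM periods, `μ(L_X) = 0 ⇒ μ(L_W) = 0`
(unit content). Meant proof: `f_W` IS its own `p`-depletion (`a_p = 0`, `U_p = 0` at `p² ∣ N`), so in Katz's ring
`V/𝔓` of generalised `p`-adic modular forms `f_W^{[S]} = f_X^{[pS]}` by the `q`-expansion principle, and the BDP
measures (Serre–Tate expansions at the ordinary CM points of conductor prime to `pN`) are `R₀`-linear in the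
depleted form [BDP 2013 §5; Kriz 2016; Lei–Müller–Xia 2023 Thm. 4.6 for `N⁻ = 1`]. The `λ`-relation with the
local Euler factors at `q ∣ N_W N_X` is the companion statement (not typed here). -/
def ResidualBdpMeasureTransportAdditive : Prop :=
  ∀ {p : ℕ} [Fact p.Prime] (ι : PadicAlgCl p ≃+* ℂ) (W X : WeierstrassCurve ℚ) [W.IsElliptic]
    [W.IsGloballyMinimal] [X.IsElliptic] [X.IsGloballyMinimal] (K : Type) [Field K] [NumberField K]
    (v : HeightOneSpectrum (𝓞 K)) (κ : ZpExtension K p) (γ : Field.absoluteGaloisGroup K)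
    {NW NX : ℕ} [NeZero NW] [NeZero NX] {fW : CuspForm (CongruenceSubgroup.Gamma0 NW) 2}
    {fX : CuspForm (CongruenceSubgroup.Gamma0 NX) 2} (_ : IsNewformOf W fW) (_ : IsNewformOf X fX)
    (ΩK : ℂ) (Ωp : (unrIntegers p)ˣ) (LW LX : UnrSeries p),
    5 ≤ p → Addv W p → ¬ (p ∣ NX) → W.HasSurjectiveModNGaloisRep p → IsCongruentModP p W X →
    IsImaginaryQuadratic K → ((Ideal.span {(p : ℤ)}).primesOver (𝓞 K)).ncard = 2 →
    (∀ (w : InfinitePlace K) (k : 𝓞 K), k ∈ v.asIdeal ↔ ‖ι.symm (w.embedding (k : K))‖ < 1) →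
    κ.IsAnticyclotomic → κ.IsTopGenerator γ →
    SatisfiesHeegnerHypothesis NW K → SatisfiesHeegnerHypothesis NX K → Odd (NumberField.discr K) →
    ΩK ≠ 0 → IsBDPLFunction ι v κ γ fW ΩK ((Ωp : unrIntegers p) : ℂ_[p]) LW →
    IsBDPLFunction ι v κ γ fX ΩK ((Ωp : unrIntegers p) : ℂ_[p]) LX →
    HasUnitContent LX → HasUnitContent LW

end Summit.BirchSwinnertonDyer.BirchSwinnertonDyer.Cruxes.LevelKolyvaginSystemsAdditive.ResidualBdpTransport

end
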